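import Literature.Analysis.FluidPDE.PeriodicLowerMassCore
import Literature.Analysis.FluidPDE.PeriodicTestedEquation
import Literature.Analysis.FluidPDE.PeriodicHalfBoxMass
import Literature.Analysis.FluidPDE.LeiZhang2011Cutoff
import Literature.Analysis.FluidPDE.NashNonlinearities
import HarnessLib

/-!
# Lei–Ren–Zhang 2019, Lemma 3.3 (tree form): a lower bound of the mass of `Φ` per period

Analysis/FluidPDE proofs file (theorems only, no definitions, no named facts), on the discharge
path of the named fact `Literature.Analysis.FluidPDE.leiRenZhang2019_liouville_periodic`
(Z. Lei, X. Ren, Q. S. Zhang, arXiv:1902.11229 = Math. Ann. 383 (2022), Theorem 1.1). Lemma 3.3 of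
the paper (arXiv p. 8): "Let `Φ` be a nonnegative `z`-periodic solution (with period `Z₀ = 1` in
the `z` direction) to (1.6) in `P_R` (`R ≥ 1`), satisfying `Φ|_{r=0} ≥ ½`. Then
`‖Φ‖_{L¹(P_R)} ≥ κR⁴` for some absolute constant `κ > 0` independent of `R`." Here, from the
analytic core `lower_mass_core_periodic` (the paper's test-function computation (3.13)–(3.15))
with the cylindrical cut-off `ζ = cylCutoff (ρ/2) ρ`, the two-sided time cut-off of
`LeiZhang2011Cutoff`, and the clamped power `H = χ_ε^{1/4}` of `NashNonlinearities` (as in the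
tree's `LeiZhang2011.lower_mass`, the power `p = 1/4` replaces the paper's `√Φ` followed by
Hölder): there is `c > 0`, depending only on the angular-potential constant `C_Φ`, such that for
every period `P`, radius `ρ`, every `0 < ε ≤ 1` and every solution `F = Φ + ε` in the periodic
swirl setting at radius `ρ` with `ε ≤ F ≤ 3` on `[−ρ², 0] × {r ≤ ρ}` and `F ≥ 1` on the axis,
`c P ρ⁴ ≤ ∫_{−ρ²}^0 ∫_{[0,P]×{r≤ρ}} F^{1/4}` (`lower_mass_periodic`).

* `lower_mass_periodic`.

## References

* Z. Lei, X. Ren, Q. S. Zhang, arXiv:1902.11229, §3, Lemma 3.3 and its proof (arXiv p. 8).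
  [LeiRenZhang2019]
* Z. Lei, Q. S. Zhang, arXiv:1011.5066, Lemma 3.4 (p. 11) (tree `LeiZhang2011.lower_mass`).
  [LeiZhang2011]
-/

noncomputable section

open MeasureTheory Set Function Filter Metric intervalIntegral
open _root_.Topology
open scoped InnerProductSpace RealInnerProductSpace NNReal ENNReal Laplacian

namespace Literature.Analysis.FluidPDE

namespace LeiRenZhang2019

open LeiZhang2011 Literature.Analysis.Pluripotential

set_option maxHeartbeats 1600000 in
-- one long assembly proof (cut-offs, the clamped power and its weight, the tested equation, the
-- core estimate, the lower bound of the boundary term, constants)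
/-- **Lemma 3.3 of Lei–Ren–Zhang 2019 (tree form): lower bound of the mass per period.** For
every angular-potential constant `C_Φ ≥ 0` there is `c > 0` such that for every period `P > 0`,
radius `ρ > 0`, every `0 < ε ≤ 1` and every solution `F` in the periodic swirl setting at radius
`ρ` (axisymmetric `P`-periodic `F(s,·) ∈ C²`, jointly continuous; `C¹` divergence-free
`P`-periodic drift `b` with angular stream potential `Φ`, `∂_zΦ = ⟪b, x_h⟫`, `|Φ| ≤ C_Φ r`; the
time-integrated equation on `[−ρ², 0]` with `N` measurable and integrable on
`(−ρ², 0] × ([0,2P] × {r ≤ ρ})`) with `ε ≤ F ≤ 3` on `[−ρ², 0] × {r ≤ ρ}` and `F ≥ 1` at the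
axis points, `c P ρ⁴ ≤ ∫_{−ρ²}^0 ∫_{{0 ≤ x₂ ≤ P, r ≤ ρ}} F^{1/4}` (printed:
"`‖Φ‖_{L¹(P_R)} ≥ κR⁴` for some absolute constant `κ > 0` independent of `R`", period
`Z₀ = 1`). [cite: LeiRenZhang2019, §3, Lemma 3.3 (arXiv p. 8)] -/
theorem lower_mass_periodic {CΦ : ℝ} (hCΦ : 0 ≤ CΦ) :
    ∃ cl : ℝ, 0 < cl ∧ ∀ ⦃P : ℝ⦄, 0 < P → ∀ ⦃ρ : ℝ⦄, 0 < ρ → ∀ ⦃ε : ℝ⦄, 0 < ε → ε ≤ 1 →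
      ∀ ⦃F N : ℝ → EuclideanSpace ℝ (Fin 3) → ℝ⦄
        ⦃b : ℝ → EuclideanSpace ℝ (Fin 3) → EuclideanSpace ℝ (Fin 3)⦄
        ⦃Φ : ℝ → EuclideanSpace ℝ (Fin 3) → ℝ⦄,
      (∀ s, ContDiff ℝ 2 (F s)) → (∀ s, IsAxisymmetricScalar (F s)) →
      (∀ s, IsAxiallyPeriodic P (F s)) →
      (∀ s, ContDiff ℝ 1 (b s)) → (∀ s x, VectorCalculus.divergence (b s) x = 0) →
      (∀ s, IsAxiallyPeriodic P (b s)) →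
      (∀ s, ContDiff ℝ 1 (Φ s)) → (∀ s, IsAxiallyPeriodic P (Φ s)) →
      (∀ s x, fderiv ℝ (Φ s) x eZ = ⟪b s x, horizPart x⟫) →
      (∀ s x, |Φ s x| ≤ CΦ * cylRadius x) →
      (∀ s x, N s x =
        (Δ (F s)) x - fderiv ℝ (F s) x (b s x) - 2 / cylRadius x * fderiv ℝ (F s) x (eR x)) →
      (∀ᵐ x ∂(volume : Measure (EuclideanSpace ℝ (Fin 3))),
        IntervalIntegrable (fun s => N s x) volume (-ρ ^ 2) 0 ∧
          ∀ s ∈ Icc (-ρ ^ 2) 0, F s x = F (-ρ ^ 2) x + ∫ τ in (-ρ ^ 2)..s, N τ x) →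
      (Continuous fun p : ℝ × EuclideanSpace ℝ (Fin 3) => F p.1 p.2) →
      AEStronglyMeasurable (fun p : ℝ × EuclideanSpace ℝ (Fin 3) => N p.1 p.2)
        ((volume.restrict (Ioc (-ρ ^ 2) 0)).prod volume) →
      Integrable (fun p : ℝ × EuclideanSpace ℝ (Fin 3) => N p.1 p.2)
        ((volume.restrict (Ioc (-ρ ^ 2) 0)).prod
          (volume.restrict {x : EuclideanSpace ℝ (Fin 3) | x 2 ∈ Icc 0 (2 * P) ∧ cylRadius x ≤ ρ})) →
      (∀ s ∈ Icc (-ρ ^ 2) 0, ∀ x, cylRadius x ≤ ρ → ε ≤ F s x ∧ F s x ≤ 3) →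
      (∀ s ∈ Icc (-ρ ^ 2) 0, ∀ z : ℝ, 1 ≤ F s (meridianPoint (0, z))) →
      cl * (P * ρ ^ 4) ≤ ∫ s in (-ρ ^ 2)..0,
        ∫ x in {x : EuclideanSpace ℝ (Fin 3) | x 2 ∈ Icc 0 P ∧ cylRadius x ≤ ρ}, F s x ^ (1 / 4 : ℝ) := by
  -- the absolute constants
  obtain ⟨Cφ, hCφ0, hCφ⟩ := exists_norm_gradient_cylCutoff_le
  obtain ⟨CT, hCT0, hCT⟩ := exists_abs_deriv_smoothTransition_le
  have hc₂ : 0 < radialConst₂ := radialConst₂_pos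
  -- `p = 1/4`, `κ = 1/3`; the coefficient of the final inequality `c₂ P ρ² ≤ (a₁/ρ²) X`
  set a₁ : ℝ := 16 / 3 * Cφ ^ 2 * (1 + CΦ ^ 2) + 56 / 3 * CT + 1 with ha₁
  have ha₁0 : 0 < a₁ := by positivity
  refine ⟨radialConst₂ / a₁, by positivity, ?_⟩
  intro P hP ρ hρ ε hε hε1 F N b Φ hF2 hFa hFp hb1 hbdiv hbp hΦ1 hΦp hΦz hΦb hN heq hFc hNm hNi hFb hFax
  -- ### elementary facts
  have hn0 : -ρ ^ 2 ≤ (0 : ℝ) := by nlinarith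
  have hρ2 : 0 ≤ ρ / 2 := by positivity
  have hρ2' : 0 < ρ / 2 := by positivity
  have hρρ : ρ / 2 < ρ := half_lt_self hρ
  have hT : 0 < ρ ^ 2 := by positivity
  have hw : 0 < ρ ^ 2 / 4 := by positivity
  have hn1 : -ρ ^ 2 ≤ -ρ ^ 2 + ρ ^ 2 / 4 := by nlinarith
  have hn2 : -ρ ^ 2 + ρ ^ 2 / 4 ≤ -(ρ ^ 2 / 4) := by nlinarith
  have hn3 : -(ρ ^ 2 / 4) ≤ (0 : ℝ) := by nlinarith
  set K : Set (EuclideanSpace ℝ (Fin 3)) := {x | x 2 ∈ Icc 0 P ∧ cylRadius x ≤ ρ} with hK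
  -- ### the nonlinearity `H = χ_ε^{1/4}` and its weight
  obtain ⟨hHC, hHpos0, hHeq0, hHd1, hHd2⟩ := clampedPow_props hε (1 / 4 : ℝ)
  obtain ⟨H, hHdef⟩ : ∃ H : ℝ → ℝ, ∀ v, H v = smoothMax (ε / 4) v (ε / 4) ^ (1 / 4 : ℝ) := ⟨_, fun _ => rfl⟩
  have hHfun : (fun v : ℝ => smoothMax (ε / 4) v (ε / 4) ^ (1 / 4 : ℝ)) = H := funext fun v => (hHdef v).symm
  rw [hHfun] at hHC hHd1 hHd2
  have hHpos : ∀ v, 0 < H v := fun v => by rw [hHdef]; exact hHpos0 v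
  have hHeq : ∀ v, ε / 2 ≤ v → H v = v ^ (1 / 4 : ℝ) := fun v hv => by rw [hHdef]; exact hHeq0 v hv
  have hH : ContDiff ℝ 2 H := hHC 2
  have hH1 : ContDiff ℝ 1 H := hHC 1
  obtain ⟨κ, hκdef⟩ : ∃ κ : ℝ, κ = 1 / 3 := ⟨_, rfl⟩
  have hκpos : 0 < κ := by rw [hκdef]; norm_num
  obtain ⟨Gw, hGwdef⟩ : ∃ Gw : ℝ → ℝ, ∀ v, Gw v = deriv H v ^ 2 / (κ * H v) := ⟨_, fun _ => rfl⟩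
  have hHdc : Continuous (deriv H) := hH.continuous_deriv (by norm_num)
  have hGwc : Continuous Gw := by
    have h : Continuous fun v => deriv H v ^ 2 / (κ * H v) :=
      (hHdc.pow 2).div (continuous_const.mul hH.continuous) fun v => mul_ne_zero hκpos.ne' (hHpos v).ne'
    exact h.congr fun v => (hGwdef v).symm
  have hGw0 : ∀ v, 0 ≤ Gw v := fun v => by
    rw [hGwdef v]; exact div_nonneg (sq_nonneg _) (mul_nonneg hκpos.le (hHpos v).le)
  have hκ : ∀ v, deriv H v ^ 2 ≤ κ * H v * Gw v := fun v => by
    have hne : κ * H v ≠ 0 := mul_ne_zero hκpos.ne' (hHpos v).ne'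
    rw [hGwdef v, mul_div_cancel₀ _ hne]
  -- `H'' = −Gw` on the range `v > ε/2`
  have hGrange : ∀ v, ε / 2 < v → deriv (deriv H) v = -Gw v := by
    intro v hv
    have hv0 : 0 < v := (half_pos hε).trans hv
    have hHv : H v = v ^ (1 / 4 : ℝ) := hHeq v hv.le
    have e1 : ((1 / 4 : ℝ) * v ^ ((1 / 4 : ℝ) - 1)) ^ 2 = 1 / 16 * (v ^ ((1 / 4 : ℝ) - 2) * v ^ (1 / 4 : ℝ)) := by
      rw [mul_pow, ← Real.rpow_natCast (v ^ ((1 / 4 : ℝ) - 1)) 2, ← Real.rpow_mul hv0.le,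
        ← Real.rpow_add hv0]
      norm_num
    have hGwv : Gw v = 3 / 16 * v ^ ((1 / 4 : ℝ) - 2) := by
      rw [hGwdef v, hHd1 v hv, hHv, e1, hκdef]
      have hvq : v ^ (1 / 4 : ℝ) ≠ 0 := (Real.rpow_pos_of_pos hv0 _).ne'
      field_simp
    rw [hHd2 v hv, hGwv]
    ring
  -- ### the cut-offs
  set ψ : EuclideanSpace ℝ (Fin 3) → ℝ := cylCutoff (ρ / 2) ρ with hψdef
  have hψ : ContDiff ℝ 2 ψ := contDiff_cylCutoff _ _
  have hψ1C : ContDiff ℝ 1 ψ := contDiff_cylCutoff _ _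
  have hψa : IsAxisymmetricScalar ψ := isAxisymmetricScalar_cylCutoff _ _
  have hψz : ∀ (x : EuclideanSpace ℝ (Fin 3)) (t : ℝ), ψ (x + t • eZ) = ψ x := cylCutoff_add_smul_eZ _ _
  have hψ1 : ∀ x, cylRadius x ≤ ρ / 2 → ψ x = 1 := fun x hx => cylCutoff_eq_one hρ2 hρρ hx
  have hψ0 : ∀ x, ρ ≤ cylRadius x → ψ x = 0 := fun x hx => cylCutoff_eq_zero hρ2 hρρ hx
  have hψ01 : ∀ x, 0 ≤ ψ x ∧ ψ x ≤ 1 := fun x => ⟨cylCutoff_nonneg _ _ _, cylCutoff_le_one _ _ _⟩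
  have hψb : ∀ x, |ψ x| ≤ 1 := fun x => by rw [abs_of_nonneg (hψ01 x).1]; exact (hψ01 x).2
  have hψzero : ψ 0 = 1 := hψ1 0 (by
    have : cylRadius (0 : EuclideanSpace ℝ (Fin 3)) = 0 := by simp [cylRadius]
    rw [this]; exact hρ2)
  obtain ⟨a, ha, haz, -, hψg⟩ := exists_gradient_cylCutoff_eq_smul_horizPart (ρ / 2) ρ
  set D : ℝ := Cφ / (ρ - ρ / 2) with hD
  have hψD : ∀ x, ‖gradient ψ x‖ ≤ D := fun x => hCφ (ρ / 2) ρ hρ2 hρρ x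
  have hD0 : 0 ≤ D := (norm_nonneg _).trans (hψD 0)
  -- the axis weight of the cut-off
  have hsub0 : 0 < ρ ^ 2 - (ρ / 2) ^ 2 := by nlinarith
  have hCax : 0 ≤ 8 * CT / (ρ ^ 2 - (ρ / 2) ^ 2) := div_nonneg (by positivity) hsub0.le
  have hψax : ∀ x, |2 / cylRadius x * fderiv ℝ (fun y => ψ y ^ 2) x (eR x)| ≤ 8 * CT / (ρ ^ 2 - (ρ / 2) ^ 2) * ψ x :=
    fun x => abs_axis_weight_cylCutoff_sq_le hρ2 hρρ hCT x
  -- the time cut-off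
  obtain ⟨hηC, hη1, hη2, hη010, hηmid0, hηD⟩ := timeCutoff₂_props (T := ρ ^ 2) (w := ρ ^ 2 / 4) hw hCT
  obtain ⟨η, hηdef⟩ : ∃ η : ℝ → ℝ, ∀ s, η s = Real.smoothTransition ((s + ρ ^ 2) / (ρ ^ 2 / 4)) *
      Real.smoothTransition (-s / (ρ ^ 2 / 4)) := ⟨_, fun _ => rfl⟩
  have hηfun : (fun s : ℝ => Real.smoothTransition ((s + ρ ^ 2) / (ρ ^ 2 / 4)) *
      Real.smoothTransition (-s / (ρ ^ 2 / 4))) = η := funext fun s => (hηdef s).symm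
  rw [hηfun] at hηC hηD
  have hη01 : ∀ s, 0 ≤ η s ∧ η s ≤ 1 := fun s => by rw [hηdef]; exact hη010 s
  have hηmid : ∀ s, -ρ ^ 2 + ρ ^ 2 / 4 ≤ s → s ≤ -(ρ ^ 2 / 4) → η s = 1 := fun s h1 h2 => by
    rw [hηdef]; exact hηmid0 s h1 h2
  set D' : ℝ := 2 * CT / (ρ ^ 2 / 4) with hD'
  have hD'0 : 0 ≤ D' := (abs_nonneg _).trans (hηD 0)
  have hη0 : η (-ρ ^ 2) = 0 := by
    rw [hηdef, show -ρ ^ 2 = -(ρ ^ 2) by ring]; exact hη1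
  have hη00 : η 0 = 0 := by rw [hηdef]; exact hη2
  have hηc : Continuous η := hηC.continuous
  have hη'c : Continuous (deriv η) := hηC.continuous_deriv le_rfl
  have hηb : ∀ s, |η s| ≤ 1 := fun s => by rw [abs_of_nonneg (hη01 s).1]; exact (hη01 s).2
  -- ### `H'' = −Gw` on the cylinder
  have hG : ∀ s ∈ Icc (-ρ ^ 2) 0, ∀ x, cylRadius x ≤ ρ → deriv (deriv H) (F s x) = -Gw (F s x) := by
    intro s hs x hx
    have hlo := (hFb s hs x hx).1
    exact hGrange _ ((half_lt_self hε).trans_le hlo)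
  -- ### the space–time integrability of the tested equation
  have hint : Integrable (fun p : ℝ × EuclideanSpace ℝ (Fin 3) =>
      (deriv H (F p.1 p.2) * N p.1 p.2 * η p.1 + H (F p.1 p.2) * deriv η p.1) *
        (ψ p.2 * periodicWindow P (p.2 2)) ^ 2) ((volume.restrict (Ioc (-ρ ^ 2) 0)).prod volume) :=
    integrable_testedEquation_window hP le_rfl le_rfl le_rfl hFc hNm hNi hH1 hηc hη'c hηb hηD hψ.continuous
      hψb hψ0
  -- ### apply the analytic core
  have hcore := lower_mass_core_periodic (T₁ := ρ ^ 2) hP hT hF2 hFa hFp hb1 hbdiv hbp hΦ1 hΦp hΦz hCΦ hΦb hN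
    heq hFc hH hHpos hGwc hGw0 hκpos.le hκ hG hψ hψa hψz hρ2' hψ1 hψ0 hψ01 hψD (ha 1) haz hψg hCax hψax
    hηC hη0 hη00 hη01 hηD hint
  -- ### the lower bound of the boundary term: `∫ η Bd ≥ c₂ P ρ²`
  have hHFc : Continuous fun p : ℝ × EuclideanSpace ℝ (Fin 3) => H (F p.1 p.2) := hH.continuous.comp hFc
  have hmpc : Continuous fun z : ℝ => meridianPoint (0, z) :=
    (contDiff_meridianPoint (n := 0)).continuous.comp (continuous_const.prodMk continuous_id)
  have hBdlo : ∀ s ∈ Icc (-ρ ^ 2) 0,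
      2 * radialConst₂ * P ≤ 2 * radialConst₂ * (ψ 0 ^ 2 * ∫ z in (0 : ℝ)..P, H (F s (meridianPoint (0, z)))) := by
    intro s hs
    rw [hψzero, one_pow, one_mul]
    refine mul_le_mul_of_nonneg_left ?_ (by positivity)
    have hone : ∀ z ∈ Icc (0 : ℝ) P, (1 : ℝ) ≤ H (F s (meridianPoint (0, z))) := by
      intro z _
      have hF1 : 1 ≤ F s (meridianPoint (0, z)) := hFax s hs z
      have hv : ε / 2 ≤ F s (meridianPoint (0, z)) := ((half_le_self hε.le).trans hε1).trans hF1
      rw [hHeq _ hv]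
      exact Real.one_le_rpow hF1 (by norm_num)
    have hci : IntervalIntegrable (fun z => H (F s (meridianPoint (0, z)))) volume 0 P :=
      ((hH.continuous.comp ((hF2 s).continuous.comp hmpc))).intervalIntegrable _ _
    calc P = ∫ z in (0 : ℝ)..P, (1 : ℝ) := by rw [intervalIntegral.integral_const, smul_eq_mul, mul_one, sub_zero]
      _ ≤ ∫ z in (0 : ℝ)..P, H (F s (meridianPoint (0, z))) :=
          intervalIntegral.integral_mono_on hP.le intervalIntegrable_const hci hone
  have hBdc : Continuous fun s => 2 * radialConst₂ * (ψ 0 ^ 2 * ∫ z in (0 : ℝ)..P, H (F s (meridianPoint (0, z)))) := by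
    have hjc : Continuous (Function.uncurry fun (s : ℝ) (z : ℝ) => H (F s (meridianPoint (0, z)))) :=
      hHFc.comp (continuous_fst.prodMk (hmpc.comp continuous_snd))
    have h := intervalIntegral.continuous_parametric_intervalIntegral_of_continuous' (μ := (volume : Measure ℝ))
      hjc 0 P
    exact continuous_const.mul (continuous_const.mul h)
  have hLHS : radialConst₂ * P * ρ ^ 2 ≤ ∫ s in (-ρ ^ 2)..0,
      η s * (2 * radialConst₂ * (ψ 0 ^ 2 * ∫ z in (0 : ℝ)..P, H (F s (meridianPoint (0, z))))) := by
    have hηBd : ∀ s ∈ Icc (-ρ ^ 2) 0, η s * (2 * radialConst₂ * P) ≤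
        η s * (2 * radialConst₂ * (ψ 0 ^ 2 * ∫ z in (0 : ℝ)..P, H (F s (meridianPoint (0, z))))) :=
      fun s hs => mul_le_mul_of_nonneg_left (hBdlo s hs) (hη01 s).1
    have h1 : ∫ s in (-ρ ^ 2)..0, η s * (2 * radialConst₂ * P) ≤ ∫ s in (-ρ ^ 2)..0,
        η s * (2 * radialConst₂ * (ψ 0 ^ 2 * ∫ z in (0 : ℝ)..P, H (F s (meridianPoint (0, z))))) :=
      intervalIntegral.integral_mono_on hn0 ((hηc.mul continuous_const).intervalIntegrable _ _)
        ((hηc.mul hBdc).intervalIntegrable _ _) hηBd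
    refine le_trans ?_ h1
    rw [intervalIntegral.integral_mul_const]
    -- `∫ η ≥ length of [−3ρ²/4, −ρ²/4] = ρ²/2`
    have h2 : ρ ^ 2 / 2 ≤ ∫ s in (-ρ ^ 2)..0, η s := by
      have hsub : ∫ s in (-ρ ^ 2 + ρ ^ 2 / 4)..(-(ρ ^ 2 / 4)), η s ≤ ∫ s in (-ρ ^ 2)..0, η s :=
        intervalIntegral.integral_mono_interval hn1 hn2 hn3
          (ae_of_all _ fun s => (hη01 s).1) (hηc.intervalIntegrable _ _)
      have hone : ∫ s in (-ρ ^ 2 + ρ ^ 2 / 4)..(-(ρ ^ 2 / 4)), η s = ρ ^ 2 / 2 := by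
        rw [intervalIntegral.integral_congr (g := fun _ => (1 : ℝ)) (fun s hs => ?_), intervalIntegral.integral_const,
          smul_eq_mul, mul_one]
        · ring
        · rw [uIcc_of_le hn2] at hs
          exact hηmid s hs.1 hs.2
      rw [← hone]
      exact hsub
    calc radialConst₂ * P * ρ ^ 2 = ρ ^ 2 / 2 * (2 * radialConst₂ * P) := by ring
      _ ≤ (∫ s in (-ρ ^ 2)..0, η s) * (2 * radialConst₂ * P) :=
          mul_le_mul_of_nonneg_right h2 (by positivity)
  -- ### the upper bound of the right-hand side: `L X` with `L ≤ a₁/ρ²`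
  set X : ℝ := ∫ s in (-ρ ^ 2)..0, ∫ x in K, H (F s x) with hX
  have hA0 : ∀ s, 0 ≤ ∫ x in K, H (F s x) := fun s => integral_nonneg fun x => (hHpos _).le
  have hX0 : 0 ≤ X := intervalIntegral.integral_nonneg hn0 fun s _ => hA0 s
  set L : ℝ := 4 * κ * D ^ 2 * (1 + CΦ ^ 2) + 8 * CT / (ρ ^ 2 - (ρ / 2) ^ 2) + D' with hL
  have hRHS : ∫ s in (-ρ ^ 2)..0, L * ∫ x in K, H (F s x) = L * X := by
    rw [hX, intervalIntegral.integral_const_mul]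
  have hmain : radialConst₂ * P * ρ ^ 2 ≤ L * X := by
    rw [← hRHS]; exact hLHS.trans hcore
  -- the constant: `L ≤ a₁/ρ²`
  have hρne : ρ ≠ 0 := hρ.ne'
  have hD2 : D ^ 2 = 4 * Cφ ^ 2 / ρ ^ 2 := by
    rw [hD, show ρ - ρ / 2 = ρ / 2 by ring, div_pow]
    field_simp
    ring
  have hLle : L ≤ a₁ / ρ ^ 2 := by
    have e : L = (16 / 3 * Cφ ^ 2 * (1 + CΦ ^ 2) + 56 / 3 * CT) / ρ ^ 2 := by
      rw [hL, hD2, hD', hκdef, show ρ ^ 2 - (ρ / 2) ^ 2 = 3 * ρ ^ 2 / 4 by ring]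
      field_simp
      ring
    rw [e, div_le_div_iff_of_pos_right hT, ha₁]
    linarith
  have hfinal : radialConst₂ * P * ρ ^ 2 ≤ a₁ / ρ ^ 2 * X :=
    hmain.trans (mul_le_mul_of_nonneg_right hLle hX0)
  -- ### conclude: `X ≥ (c₂/a₁) P ρ⁴` and `X = ∫∫ F^{1/4}`
  have hXlo : radialConst₂ / a₁ * (P * ρ ^ 4) ≤ X := by
    rw [div_mul_eq_mul_div, div_le_iff₀ ha₁0]
    have h := mul_le_mul_of_nonneg_right hfinal (le_of_lt hT)
    have e1 : radialConst₂ * P * ρ ^ 2 * ρ ^ 2 = radialConst₂ * (P * ρ ^ 4) := by ring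
    have e2 : a₁ / ρ ^ 2 * X * ρ ^ 2 = X * a₁ := by field_simp
    rw [e1, e2] at h
    exact h
  refine hXlo.trans (le_of_eq ?_)
  simp only [hX]
  refine intervalIntegral.integral_congr fun s hs => ?_
  rw [uIcc_of_le hn0] at hs
  refine setIntegral_congr_fun (isCompact_halfPeriodBox P ρ).isClosed.measurableSet fun x hx => ?_
  show H (F s x) = F s x ^ (1 / 4 : ℝ)
  exact hHeq _ ((half_le_self hε.le).trans (hFb s hs x hx.2).1)

end LeiRenZhang2019

end Literature.Analysis.FluidPDE

end
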